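import Summits.QuantumFields.BalabanUV.Beta.FP.LatticeConvolutionBounds
import Summits.QuantumFields.BalabanUV.Beta.FP.StencilMoments

/-!
# `BalabanUV.Beta.FP.MixLoopPowerCounting` — road «FP» (binder row D1), remainder `ρ_n` of the H′ bookkeeping, row **RHOA-6c** «GENERIC POWER
# COUNTING OF THE MIX LOOPS», FILE A of three: the shell engine with EXACT `n`-powers, and the loops **(MIX-4)** `tr(Q̈·𝓘)`, **(MIX-2)** `−tr(Q̇𝓘·Q̇𝓘)`
# FROM THEIR LETTERS ([folklore] lattice bookkeeping on `ℤ⁴`; abstract kernels, every letter a displayed hypothesis; NO road object)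

HONEST DEPENDENCY (page 1, mandatory): continuum YM on T⁴ ⇐ BetaPertH ∧ nine spine estimates (0/9 proved); BetaPertH ⇐ (D1) ∧ (D4) ∧
CAP+tail; G-an2-4 gates asym, D1 and NE2/3/4.  HONEST FRAMING (cell contract, verbatim): «discharging `BetaPertH` makes Bałaban's UV
stability UNCONDITIONAL — a real constructive-QFT result; it is NOT the continuum limit and NOT the Clay problem.»  THIS MODULE is elementary
[folklore] real analysis on `ℤ⁴` over the tree's shell machinery BY NAME (`TransferUV.card_annulus_succ_four_le` `#shell ≤ 80(r+1)³`,
`TransferUV.sum_annulus_zero_eq_sum_shells`, `StencilMoments.pow_succ_mul_exp_le'`, `LatticeConvolutionBounds.exists_subset_box`); it asserts nothing about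
Bałaban's objects, cites nothing, mints no `Prop` fact, has no `def`, 0 sorry.  The LETTERS of the averaging jets `q̇`, `q̈` (row RHOA-6b), of the interpolation
`𝓘` (row IR-I) are HYPOTHESES displayed in the signatures; NOT `Mix_n = O(1)` for Bałaban's objects (row RHOA-6e assembles), NOT `hbook`, NOT D1, NOT BetaPertH,
NOT continuum, NOT Clay.

ROW (owner b2b-balaban-beta-d1-p3-g6, `RHOA-DESIGN.md` v1.1 §2bis, `LEAVES-FP.md` «RHOA-6c (GENERIC POWER COUNTING, M) four lattice lemmas ‹letters
(q̇)(𝓘)(Γ₀)(G_C)(Ḣ) ⟹ Σ_z|k_{MIX-i}(z)|·|z|² ≤ C_i n-free›, i = 1…4»).  §2bis: (MIX-2) `−tr(G_CQ̇AG_CQ̇A) = −tr(Q̇𝓘·Q̇𝓘)`, (MIX-4) `½tr(G_C(Q̈A + AᵀQ̈ᵀ)) = tr(Q̈·𝓘)`;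
letters «(q̇) … `Σ_u|q̇(u;b′,b)| ≤ n⁻⁵·(n−t) ≤ n⁻⁴`; given `b′`, fewer than `n` partners `b` ⟹ the β-insertion operator norm letter `n·n⁻⁴ = n⁻³`; (q̈) likewise `n⁻³`
per ordered pair of insertions, support collinear of length `< n`», «(𝓘) `|𝓘(b,u)| ≤ C e^{−δ·dist(b,nu)/n}`»; power counting «(MIX-4) `Σ_t n⁻³·O(1)·t² ≤ n⁻³·n³ = O(1)`;
(MIX-2) `k ~ (n⁻³)²·e^{−δ|z|/n}`: `n⁻⁶·Σ_{|z|≲n}|z|² ~ n⁻⁶·n⁶ = O(1)`» — fine sup-distance `|z|`.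

ABSTRACT CURRENCY (this file and its two sequels).  Fine AND coarse sites are `DyadicShell.Pt = ℤ⁴`, distances are `supNorm`, the blocking is `n ≥ 1`,
the block anchor of a coarse site `u` is `(n:ℤ)•u`.  An insertion of the background at the fine point `b` is seen by the finitely many coarse sites `u ∈ U b`
(LOCALITY `‖b − n•u‖∞ ≤ n`); the averaging 3-jet `q̇(u;b,c)` is read as `qd u b c` on the translation-invariant field-leg support `c = b + w`, `w ∈ W`
(`‖w‖∞ ≤ n`; print: `w = t·e_μ`, `0 < t < n` — only the radius and, in FILE B, the cardinality `#W ≤ N₀·n` are used); the 4-jet is `qdd u b b′ c`, its second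
insertion at `b′ = b + v`, `v ∈ V` (`‖v‖∞ ≤ n`, `#V ≤ N_V·n`); the interpolation is `I c u`.  Loop kernels in the two insertions `(b,b′)` are written INLINE as
finite sums; conclusions are bounds on `Σ_{b′∈S} ‖b′−b‖∞²·|k(b,b′)|` uniform in `b` and in the finite set `S` — whence `tsum` bounds and the consumer's coordinate
moments (`|z_μz_ν| ≤ ‖z‖∞²`, `abs_coord_mul_coord_le`).

CONTENT.
* §1 ENGINE (exact powers): `card_shell_mul_weight_le`, **`sum_shellWeight_le`** (geometric shell tail `Σ_{r<M} e^{−x(r+1)} ≤ 1∕x` inlined)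
  (`Σ_{z∈S}(‖z‖+1)^j∕(‖z‖+1)³·e^{−(δ∕n)‖z‖} ≤ (1 + 80·j!·e^{δ∕2}(2∕δ)^{j+1})·n^{j+1}`), the monotone wrapper `sum_le_engine_of_le`, and the two instances used
  here, `sum_exp_le` (`j = 3`: `n⁴`) and `sum_sq_mul_exp_le` (`j = 5`: `n⁶`); FILES B∕C instantiate `j = 0, 1, 2` (`n`, `n²`, `n³`) for (MIX-1), (MIX-3).
* §2 (MIX-4): `abs_mix4_le` (`|k₄| ≤ C_I·A₂∕n³`), **`mix4_secondMoment_le`** (`Σ_{v∈V}‖v‖²|k₄(b,b+v)| ≤ A₂·C_I·N_V`): only the SUP letter of `𝓘` is used.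
* §3 (MIX-2): `exp_leg_le` (the leg comparison `e^{−(δ∕n)‖b+w−n•u′‖} ≤ e^{2δ}e^{−(δ∕n)‖b′−b‖}` for `u′` seeing `b′`), `abs_smearedLeg_le`, **`abs_mix2_le`** (the
  pointwise shape `(A∕n³)²(C_Ie^{2δ})²e^{−(2δ∕n)‖b′−b‖}`), **`mix2_secondMoment_le`** (`≤ A²(C_Ie^{2δ})²(1 + 9600·e^{δ}·δ⁻⁶)`, n-FREE).
(MIX-1) `tr(G_C·Q̇Γ₀Q̇ᵀ)` and (MIX-3) `−2tr(Q̇Γ₀Ḣ𝓘)` are summed VERTEX-FIRST in FILES B∕C (`MixLoopPowerCountingGamma`, `MixLoopPowerCountingCubic`): their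
pointwise shapes in §2bis are heuristic at near-collinear separations (journal I-ne7bleaf01g23-1), the second moments are O(1) with the exact power.
Provenance: cross-cell idle-seat kernel duty NE7b → β∕D1, unit `b2b-balaban-t4-ne7b-formalise-leaf-01` gen 23 (prover-…-leaf-01-g23-0), 2026-08-21;
journal INTENT ∕ CLAIM «RHOA-6c» l.23908; «not in print; our bookkeeping»; no existing file touched.
-/

noncomputable section

namespace Summit.QuantumFields.BalabanUV.Beta.FP.MixLoopPowerCounting

open Finset Real
open scoped BigOperators
open Literature.Probability.LatticeModels (box mem_box box_mono zero_mem_box annulus mem_annulus)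
open Literature.MathematicalPhysics.QuantumFieldTheory.Balaban1983to89.Beta.TransferUV (card_annulus_succ_four_le
  sum_annulus_zero_eq_sum_shells)
open Literature.MathematicalPhysics.QuantumFieldTheory.Balaban1983to89.Beta.DyadicShell (Pt supNorm mem_box_iff
  supNorm_eq_zero_iff supNorm_eq_of_mem_sphere)
open Literature.MathematicalPhysics.QuantumFieldTheory.Balaban1983to89.Beta.GradedBubbles (supNorm_neg)
open Literature.MathematicalPhysics.QuantumFieldTheory.Balaban1983to89.Beta.BlockLegs (supNorm_sub_le_real supNorm_add_le_real)
open Summit.QuantumFields.BalabanUV.Beta.FP.LatticeConvolutionBounds (exists_subset_box)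
open Summit.QuantumFields.BalabanUV.Beta.FP.BlockAveragedKernel (box_four_zero)
open Summit.QuantumFields.BalabanUV.Beta.FP.StencilMoments (pow_succ_mul_exp_le')

/-! ## §1 The shell engine with exact `n`-powers -/

/-- [folklore] **ONE SHELL, EXACT POWER**: `#{‖z‖∞ = r+1}·(r+2)^j∕(r+2)³·e^{−(δ∕n)(r+1)} ≤ 80·n^j·(j!·e^{δ∕2}·(2∕δ)^j)·e^{−(δ∕2∕n)(r+1)}`
(`#shell ≤ 80(r+1)³ ≤ 80(r+2)³` and `StencilMoments.pow_succ_mul_exp_le'` at `L := (r+1)∕n`, `(r+2)∕n ≤ L + 1` for `n ≥ 1`). -/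
theorem card_shell_mul_weight_le (j : ℕ) {δ : ℝ} (hδ : 0 < δ) {n : ℕ} (hn : 1 ≤ n) (r : ℕ) :
    ((annulus 4 r (r + 1)).card : ℝ) * (((r : ℝ) + 2) ^ j / ((r : ℝ) + 2) ^ 3 * Real.exp (-(δ / n) * ((r : ℝ) + 1)))
      ≤ 80 * (n : ℝ) ^ j * ((j.factorial : ℝ) * Real.exp (δ / 2) * (2 / δ) ^ j)
          * Real.exp (-(δ / 2 / n) * ((r : ℝ) + 1)) := by
  have hn' : (0 : ℝ) < n := by exact_mod_cast hn
  have hr1 : (0 : ℝ) < (r : ℝ) + 1 := by positivity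
  have hr2 : (0 : ℝ) < (r : ℝ) + 2 := by positivity
  set L : ℝ := ((r : ℝ) + 1) / n with hL
  have hL0 : 0 ≤ L := by positivity
  have hc : ((annulus 4 r (r + 1)).card : ℝ) ≤ 80 * ((r : ℝ) + 2) ^ 3 :=
    (card_annulus_succ_four_le r).trans (by gcongr; linarith)
  have hpow : ((r : ℝ) + 2) ^ j ≤ (n : ℝ) ^ j * (L + 1) ^ j := by
    rw [← mul_pow]
    apply pow_le_pow_left₀ hr2.le
    rw [hL, mul_add, mul_div_cancel₀ _ hn'.ne', mul_one]
    linarith [show (1 : ℝ) ≤ n by exact_mod_cast hn]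
  have hexp : Real.exp (-(δ / n) * ((r : ℝ) + 1)) = Real.exp (-δ * L) := by rw [hL]; congr 1; field_simp
  have hexp' : Real.exp (-(δ / 2 / n) * ((r : ℝ) + 1)) = Real.exp (-(δ / 2) * L) := by rw [hL]; congr 1; field_simp
  have hmain := pow_succ_mul_exp_le' j hδ hL0
  calc ((annulus 4 r (r + 1)).card : ℝ) * (((r : ℝ) + 2) ^ j / ((r : ℝ) + 2) ^ 3 * Real.exp (-(δ / n) * ((r : ℝ) + 1)))
      ≤ (80 * ((r : ℝ) + 2) ^ 3) * (((r : ℝ) + 2) ^ j / ((r : ℝ) + 2) ^ 3 * Real.exp (-(δ / n) * ((r : ℝ) + 1))) :=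
        mul_le_mul_of_nonneg_right hc (by positivity)
    _ = 80 * (((r : ℝ) + 2) ^ j * Real.exp (-δ * L)) := by
        rw [hexp]; field_simp
    _ ≤ 80 * ((n : ℝ) ^ j * ((L + 1) ^ j * Real.exp (-δ * L))) := by
        rw [← mul_assoc ((n : ℝ) ^ j)]
        gcongr
    _ ≤ 80 * ((n : ℝ) ^ j * (((j.factorial : ℝ) * Real.exp (δ / 2) * (2 / δ) ^ j) * Real.exp (-(δ / 2) * L))) := by
        gcongr
    _ = _ := by rw [hexp']; ring

/-- [folklore] **THE SHELL ENGINE WITH EXACT n-POWERS**: for every finite `S ⊆ ℤ⁴`, every `j`, `δ > 0`, `n ≥ 1`,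
`Σ_{z∈S} (‖z‖∞+1)^j∕(‖z‖∞+1)³·e^{−(δ∕n)‖z‖∞} ≤ (1 + 80·j!·e^{δ∕2}·(2∕δ)^{j+1})·n^{j+1}` — the origin contributes `1 ≤ n^{j+1}`, the shells
`80·n^j·(j!e^{δ∕2}(2∕δ)^j)·Σ_r e^{−(δ∕2∕n)(r+1)} ≤ 80·n^j·(…)·(2n∕δ)`.  EXACT: `j = 3` (pure exponential) gives `n⁴`, `j = 5` (second moment) `n⁶`,
`j = 1` (`(‖z‖+1)⁻²`) `n²`, `j = 0` (`(‖z‖+1)⁻³`) `n`. -/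
theorem sum_shellWeight_le (j : ℕ) {δ : ℝ} (hδ : 0 < δ) {n : ℕ} (hn : 1 ≤ n) (S : Finset Pt) :
    ∑ z ∈ S, ((supNorm z : ℝ) + 1) ^ j / ((supNorm z : ℝ) + 1) ^ 3 * Real.exp (-(δ / n) * (supNorm z : ℝ))
      ≤ (1 + 80 * (j.factorial : ℝ) * Real.exp (δ / 2) * (2 / δ) ^ (j + 1)) * (n : ℝ) ^ (j + 1) := by
  have hn' : (0 : ℝ) < n := by exact_mod_cast hn
  have hn1 : (1 : ℝ) ≤ n := by exact_mod_cast hn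
  set f : Pt → ℝ := fun z => ((supNorm z : ℝ) + 1) ^ j / ((supNorm z : ℝ) + 1) ^ 3 * Real.exp (-(δ / n) * (supNorm z : ℝ))
    with hf
  have hf0 : ∀ z, 0 ≤ f z := fun z => by rw [hf]; positivity
  obtain ⟨L, hL⟩ := exists_subset_box S
  have h1 : ∑ z ∈ S, f z ≤ ∑ z ∈ box 4 L, f z := Finset.sum_le_sum_of_subset_of_nonneg hL fun z _ _ => hf0 z
  have hsplit : ∑ z ∈ box 4 L, f z = ∑ z ∈ annulus 4 0 L, f z + ∑ z ∈ box 4 0, f z := by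
    rw [annulus, Finset.sum_sdiff (box_mono 4 (Nat.zero_le L))]
  have h0 : f 0 = 1 := by
    have : supNorm (0 : Pt) = 0 := supNorm_eq_zero_iff.mpr rfl
    simp [hf, this]
  -- shells
  set K : ℝ := (j.factorial : ℝ) * Real.exp (δ / 2) * (2 / δ) ^ j with hK
  have hK0 : 0 ≤ K := by positivity
  have hshell : ∀ r : ℕ, ∑ z ∈ annulus 4 r (r + 1), f z ≤ 80 * (n : ℝ) ^ j * K * Real.exp (-(δ / 2 / n) * ((r : ℝ) + 1)) := by
    intro r
    have hcongr : ∀ z ∈ annulus 4 r (r + 1),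
        f z = ((r : ℝ) + 2) ^ j / ((r : ℝ) + 2) ^ 3 * Real.exp (-(δ / n) * ((r : ℝ) + 1)) := by
      intro z hz
      have hs : (supNorm z : ℝ) = (r : ℝ) + 1 := by rw [supNorm_eq_of_mem_sphere hz]; push_cast; ring
      show ((supNorm z : ℝ) + 1) ^ j / ((supNorm z : ℝ) + 1) ^ 3 * Real.exp (-(δ / n) * (supNorm z : ℝ)) = _
      rw [hs, show (r : ℝ) + 1 + 1 = (r : ℝ) + 2 by ring]
    have hconst : ∑ z ∈ annulus 4 r (r + 1), f z
        = ((annulus 4 r (r + 1)).card : ℝ) * (((r : ℝ) + 2) ^ j / ((r : ℝ) + 2) ^ 3 * Real.exp (-(δ / n) * ((r : ℝ) + 1))) := by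
      rw [Finset.sum_congr rfl hcongr, Finset.sum_const, nsmul_eq_mul]
    rw [hconst]
    exact card_shell_mul_weight_le j hδ hn r
  have hx : 0 < δ / 2 / n := by positivity
  have hshells : ∑ z ∈ annulus 4 0 L, f z ≤ 80 * (n : ℝ) ^ j * K * (2 * n / δ) := by
    rw [sum_annulus_zero_eq_sum_shells]
    calc ∑ r ∈ Finset.range L, ∑ z ∈ annulus 4 r (r + 1), f z
        ≤ ∑ r ∈ Finset.range L, 80 * (n : ℝ) ^ j * K * Real.exp (-(δ / 2 / n) * ((r : ℝ) + 1)) := Finset.sum_le_sum fun r _ => hshell r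
      _ = 80 * (n : ℝ) ^ j * K * ∑ r ∈ Finset.range L, Real.exp (-(δ / 2 / n) * ((r : ℝ) + 1)) := by rw [Finset.mul_sum]
      _ ≤ 80 * (n : ℝ) ^ j * K * (1 / (δ / 2 / n)) := by
          -- the geometric shell tail `Σ_{r<L} e^{−x(r+1)} ≤ 1∕x`, `x = δ∕2∕n` (telescoping `e^{−x(r+1)} ≤ (e^{−xr} − e^{−x(r+1)})∕x` from `1 + x ≤ eˣ`;
          -- the same inequality is `Literature.NumberTheory.EllipticCurves.sum_range_exp_neg_mul_succ_le`, not imported to keep the cone local)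
          gcongr with r
          set x : ℝ := δ / 2 / n
          have key : ∀ r : ℕ, Real.exp (-x * ((r : ℝ) + 1)) ≤ (Real.exp (-x * (r : ℝ)) - Real.exp (-x * ((r : ℝ) + 1))) / x := by
            intro r
            rw [le_div_iff₀ hx, show Real.exp (-x * (r : ℝ)) = Real.exp (-x * ((r : ℝ) + 1)) * Real.exp x by
              rw [← Real.exp_add]; congr 1; ring]
            nlinarith [Real.exp_pos (-x * ((r : ℝ) + 1)), Real.add_one_le_exp x]
          have htel : ∀ M : ℕ, ∑ r ∈ Finset.range M, (Real.exp (-x * (r : ℝ)) - Real.exp (-x * ((r : ℝ) + 1))) / x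
              = (1 - Real.exp (-x * (M : ℝ))) / x := by
            intro M
            induction M with
            | zero => simp
            | succ M ih => rw [Finset.sum_range_succ, ih]; push_cast; ring
          calc ∑ r ∈ Finset.range L, Real.exp (-x * ((r : ℝ) + 1))
              ≤ ∑ r ∈ Finset.range L, (Real.exp (-x * (r : ℝ)) - Real.exp (-x * ((r : ℝ) + 1))) / x :=
                Finset.sum_le_sum fun r _ => key r
            _ = (1 - Real.exp (-x * (L : ℝ))) / x := htel L
            _ ≤ 1 / x := by gcongr; linarith [Real.exp_pos (-x * (L : ℝ))]
      _ = 80 * (n : ℝ) ^ j * K * (2 * n / δ) := by congr 1; field_simp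
  calc ∑ z ∈ S, f z ≤ ∑ z ∈ box 4 L, f z := h1
    _ = ∑ z ∈ annulus 4 0 L, f z + 1 := by rw [hsplit, box_four_zero, Finset.sum_singleton, h0]
    _ ≤ 80 * (n : ℝ) ^ j * K * (2 * n / δ) + (n : ℝ) ^ (j + 1) := by
        gcongr
        exact one_le_pow₀ hn1
    _ = (1 + 80 * (j.factorial : ℝ) * Real.exp (δ / 2) * (2 / δ) ^ (j + 1)) * (n : ℝ) ^ (j + 1) := by
        rw [hK]; ring


/-- [folklore] Monotone wrapper of the engine: any weight dominated by the `j`-th engine profile has the `j`-th engine bound. -/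
theorem sum_le_engine_of_le (j : ℕ) {δ : ℝ} (hδ : 0 < δ) {n : ℕ} (hn : 1 ≤ n) {w : Pt → ℝ}
    (hw : ∀ z, w z ≤ ((supNorm z : ℝ) + 1) ^ j / ((supNorm z : ℝ) + 1) ^ 3 * Real.exp (-(δ / n) * (supNorm z : ℝ)))
    (S : Finset Pt) :
    ∑ z ∈ S, w z ≤ (1 + 80 * (j.factorial : ℝ) * Real.exp (δ / 2) * (2 / δ) ^ (j + 1)) * (n : ℝ) ^ (j + 1) :=
  (Finset.sum_le_sum fun z _ => hw z).trans (sum_shellWeight_le j hδ hn S)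

/-- [folklore] `1 ≤ ‖z‖∞ + 1` and `0 ≤ ‖z‖∞` (real casts). -/
theorem supNorm_cast_nonneg (z : Pt) : (0 : ℝ) ≤ (supNorm z : ℝ) := Nat.cast_nonneg _

/-- [folklore] **PURE EXPONENTIAL, EXACT POWER n⁴**: `Σ_{z∈S} e^{−(δ∕n)‖z‖∞} ≤ (1 + 480·e^{δ∕2}·(2∕δ)⁴)·n⁴`. -/
theorem sum_exp_le {δ : ℝ} (hδ : 0 < δ) {n : ℕ} (hn : 1 ≤ n) (S : Finset Pt) :
    ∑ z ∈ S, Real.exp (-(δ / n) * (supNorm z : ℝ)) ≤ (1 + 480 * Real.exp (δ / 2) * (2 / δ) ^ 4) * (n : ℝ) ^ 4 := by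
  have h := sum_le_engine_of_le 3 hδ hn (w := fun z => Real.exp (-(δ / n) * (supNorm z : ℝ))) (fun z => ?_) S
  · refine h.trans (le_of_eq ?_); norm_num [Nat.factorial]
  · have h1 : (0 : ℝ) < (supNorm z : ℝ) + 1 := by linarith [supNorm_cast_nonneg z]
    rw [div_self (pow_ne_zero 3 h1.ne'), one_mul]

/-- [folklore] **SECOND MOMENT OF THE EXPONENTIAL, EXACT POWER n⁶**: `Σ_{z∈S} ‖z‖∞²·e^{−(δ∕n)‖z‖∞} ≤ (1 + 9600·e^{δ∕2}·(2∕δ)⁶)·n⁶`. -/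
theorem sum_sq_mul_exp_le {δ : ℝ} (hδ : 0 < δ) {n : ℕ} (hn : 1 ≤ n) (S : Finset Pt) :
    ∑ z ∈ S, (supNorm z : ℝ) ^ 2 * Real.exp (-(δ / n) * (supNorm z : ℝ))
      ≤ (1 + 9600 * Real.exp (δ / 2) * (2 / δ) ^ 6) * (n : ℝ) ^ 6 := by
  have h := sum_le_engine_of_le 5 hδ hn (w := fun z => (supNorm z : ℝ) ^ 2 * Real.exp (-(δ / n) * (supNorm z : ℝ)))
    (fun z => ?_) S
  · refine h.trans (le_of_eq ?_); norm_num [Nat.factorial]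
  · have h0 := supNorm_cast_nonneg z
    have h1 : (0 : ℝ) < (supNorm z : ℝ) + 1 := by linarith
    have e : ((supNorm z : ℝ) + 1) ^ 5 / ((supNorm z : ℝ) + 1) ^ 3 = ((supNorm z : ℝ) + 1) ^ 2 := by
      rw [div_eq_iff (pow_ne_zero 3 h1.ne')]; ring
    rw [e]
    gcongr
    linarith

/-- [folklore] Coordinates are dominated by the sup norm: `|z_μ·z_ν| ≤ ‖z‖∞²` — so every `Σ ‖z‖∞²·|k|` bound below dominates the consumer's
second moments `Σ k(z)·z_μ·z_ν` (`FP/HorizontalTailAssemblyDefect` currency). -/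
theorem abs_coord_mul_coord_le (z : Pt) (μ ν : Fin 4) : |(z μ : ℝ) * (z ν : ℝ)| ≤ (supNorm z : ℝ) ^ 2 := by
  have h : ∀ i : Fin 4, |(z i : ℝ)| ≤ (supNorm z : ℝ) := fun i => by
    rw [← Int.cast_abs, Int.abs_eq_natAbs]
    exact_mod_cast Literature.MathematicalPhysics.QuantumFieldTheory.Balaban1983to89.Beta.DyadicShell.natAbs_le_supNorm z i
  rw [abs_mul, sq]
  exact mul_le_mul (h μ) (h ν) (abs_nonneg _) (supNorm_cast_nonneg z)

/-! ## §2 (MIX-4) `tr(Q̈·𝓘)` — the averaging 4-jet tadpole on the interpolation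

Letters used: the 4-jet's insertion offsets `b′ − b ∈ V` have `‖v‖∞ ≤ n` and number `#V ≤ N_V·n` (print: collinear, `0 < |t| < n`, four directions),
its total mass per ordered pair of insertions is `≤ A₂∕n³`, and ONLY the sup letter `|𝓘| ≤ C_I` of the interpolation (its exponential localisation is idle here). -/

/-- **(MIX-4) POINTWISE**: `|k₄(b,b′)| = |Σ_{u∈U b} Σ_{w∈W} q̈(u;b,b′;b+w)·𝓘(b+w,u)| ≤ C_I·A₂∕n³`. [folklore] -/
theorem abs_mix4_le {U : Pt → Finset Pt} {W : Finset Pt} {qdd : Pt → Pt → Pt → Pt → ℝ} {I : Pt → Pt → ℝ}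
    {A₂ C_I : ℝ} {n : ℕ} (hI : ∀ c u, |I c u| ≤ C_I)
    (hqdd : ∀ b b' : Pt, ∑ u ∈ U b, ∑ w ∈ W, |qdd u b b' (b + w)| ≤ A₂ / (n : ℝ) ^ 3) (b b' : Pt) :
    |∑ u ∈ U b, ∑ w ∈ W, qdd u b b' (b + w) * I (b + w) u| ≤ C_I * (A₂ / (n : ℝ) ^ 3) := by
  have hC : 0 ≤ C_I := (abs_nonneg _).trans (hI b b)
  calc |∑ u ∈ U b, ∑ w ∈ W, qdd u b b' (b + w) * I (b + w) u|
      ≤ ∑ u ∈ U b, |∑ w ∈ W, qdd u b b' (b + w) * I (b + w) u| := Finset.abs_sum_le_sum_abs _ _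
    _ ≤ ∑ u ∈ U b, ∑ w ∈ W, |qdd u b b' (b + w)| * C_I := by
        refine Finset.sum_le_sum fun u _ => (Finset.abs_sum_le_sum_abs _ _).trans (Finset.sum_le_sum fun w _ => ?_)
        rw [abs_mul]
        exact mul_le_mul_of_nonneg_left (hI _ _) (abs_nonneg _)
    _ = C_I * ∑ u ∈ U b, ∑ w ∈ W, |qdd u b b' (b + w)| := by
        rw [Finset.mul_sum]
        refine Finset.sum_congr rfl fun u _ => ?_
        rw [Finset.mul_sum]
        exact Finset.sum_congr rfl fun w _ => mul_comm _ _
    _ ≤ C_I * (A₂ / (n : ℝ) ^ 3) := mul_le_mul_of_nonneg_left (hqdd b b') hC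

/-- **(MIX-4) SECOND MOMENT, n-FREE**: `Σ_{v∈V} ‖v‖∞²·|k₄(b,b+v)| ≤ A₂·C_I·N_V` — `#V ≤ N_V·n` insertions at sup-distance `≤ n`, each
`≤ C_I·A₂∕n³`: `N_V n · n² · n⁻³`, the EXACT power (RHOA-DESIGN §2bis: «support collinear, `< n` terms: `Σ_t n⁻³·t² ≤ n⁻³·n³`»). [folklore] -/
theorem mix4_secondMoment_le {U : Pt → Finset Pt} {W V : Finset Pt} {qdd : Pt → Pt → Pt → Pt → ℝ} {I : Pt → Pt → ℝ}
    {A₂ C_I N_V : ℝ} {n : ℕ} (hn : 1 ≤ n) (hI : ∀ c u, |I c u| ≤ C_I)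
    (hqdd : ∀ b b' : Pt, ∑ u ∈ U b, ∑ w ∈ W, |qdd u b b' (b + w)| ≤ A₂ / (n : ℝ) ^ 3)
    (hV : ∀ v ∈ V, supNorm v ≤ n) (hVcard : (V.card : ℝ) ≤ N_V * n) (b : Pt) :
    ∑ v ∈ V, (supNorm v : ℝ) ^ 2 * |∑ u ∈ U b, ∑ w ∈ W, qdd u b (b + v) (b + w) * I (b + w) u| ≤ A₂ * C_I * N_V := by
  have hn' : (0 : ℝ) < n := by exact_mod_cast hn
  have hC : 0 ≤ C_I := (abs_nonneg _).trans (hI b b)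
  have hA : 0 ≤ A₂ / (n : ℝ) ^ 3 :=
    le_trans (Finset.sum_nonneg fun u _ => Finset.sum_nonneg fun w _ => abs_nonneg _) (hqdd b b)
  have hA' : 0 ≤ A₂ := by
    have := mul_nonneg hA (pow_nonneg hn'.le 3)
    rwa [div_mul_cancel₀ _ (pow_ne_zero 3 hn'.ne')] at this
  calc ∑ v ∈ V, (supNorm v : ℝ) ^ 2 * |∑ u ∈ U b, ∑ w ∈ W, qdd u b (b + v) (b + w) * I (b + w) u|
      ≤ ∑ v ∈ V, (n : ℝ) ^ 2 * (C_I * (A₂ / (n : ℝ) ^ 3)) := by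
        refine Finset.sum_le_sum fun v hv => mul_le_mul ?_ (abs_mix4_le hI hqdd b (b + v)) (abs_nonneg _) (by positivity)
        exact pow_le_pow_left₀ (supNorm_cast_nonneg v) (by exact_mod_cast hV v hv) 2
    _ = (V.card : ℝ) * ((n : ℝ) ^ 2 * (C_I * (A₂ / (n : ℝ) ^ 3))) := by rw [Finset.sum_const, nsmul_eq_mul]
    _ ≤ (N_V * n) * ((n : ℝ) ^ 2 * (C_I * (A₂ / (n : ℝ) ^ 3))) := mul_le_mul_of_nonneg_right hVcard (by positivity)
    _ = A₂ * C_I * N_V := by field_simp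


/-! ## §3 (MIX-2) `−tr(Q̇𝓘·Q̇𝓘)` — two averaging 3-jets, two interpolations

Letters used: averaging LOCALITY `‖b − n•u‖∞ ≤ n` for `u ∈ U b`, field-leg offsets `‖w‖∞ ≤ n`, the 3-jet's total mass `Σ_{u,w}|q̇| ≤ A∕n³` per insertion,
and the interpolation's exponential letter `|𝓘(c,u)| ≤ C_I·e^{−(δ∕n)‖c − n•u‖∞}`.  The loop kernel in the two insertions `(b, b′)` is the finite sum
`k₂(b,b′) = Σ_{u∈U b} Σ_{u′∈U b′} (Σ_{w∈W} q̇(u;b,b+w)·𝓘(b+w,u′))·(Σ_{w′∈W} q̇(u′;b′,b′+w′)·𝓘(b′+w′,u))`. -/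

section Mix2

variable {U : Pt → Finset Pt} {W : Finset Pt} {qd : Pt → Pt → Pt → ℝ} {I : Pt → Pt → ℝ} {A C_I δ : ℝ} {n : ℕ}

/-- [folklore] **THE LEG COMPARISON**: an interpolation leg from the field point `b + w` of the insertion at `b` to a coarse site `u′` that SEES the
insertion at `b′` decays in the separation of the insertions: `e^{−(δ∕n)‖b + w − n•u′‖∞} ≤ e^{2δ}·e^{−(δ∕n)‖b′ − b‖∞}`
(`‖b′ − b‖ ≤ ‖b′ − n•u′‖ + ‖b + w − n•u′‖ + ‖w‖ ≤ 2n + ‖b + w − n•u′‖`). -/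
theorem exp_leg_le (hδ : 0 < δ) (hn : 1 ≤ n) (hW : ∀ w ∈ W, supNorm w ≤ n) {b' u' w : Pt}
    (hu' : supNorm (b' - (n : ℤ) • u') ≤ n) (hw : w ∈ W) (b : Pt) :
    Real.exp (-(δ / n) * (supNorm (b + w - (n : ℤ) • u') : ℝ)) ≤ Real.exp (2 * δ) * Real.exp (-(δ / n) * (supNorm (b' - b) : ℝ)) := by
  have hn' : (0 : ℝ) < n := by exact_mod_cast hn
  have htri : (supNorm (b' - b) : ℝ) ≤ n + (supNorm (b + w - (n : ℤ) • u') : ℝ) + n := by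
    have e : b' - b = (b' - (n : ℤ) • u') - (b + w - (n : ℤ) • u') + w := by abel
    have h1 := supNorm_add_le_real ((b' - (n : ℤ) • u') - (b + w - (n : ℤ) • u')) w
    have h2 := supNorm_sub_le_real (b' - (n : ℤ) • u') (b + w - (n : ℤ) • u')
    have h3 : (supNorm (b' - (n : ℤ) • u') : ℝ) ≤ n := by exact_mod_cast hu'
    have h4 : (supNorm w : ℝ) ≤ n := by exact_mod_cast hW w hw
    rw [e]; linarith
  rw [← Real.exp_add]
  apply Real.exp_le_exp.mpr
  have hdn : 0 < δ / n := by positivity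
  have : -(δ / n) * (supNorm (b' - b) : ℝ) ≥ -(δ / n) * (n + (supNorm (b + w - (n : ℤ) • u') : ℝ) + n) := by nlinarith
  have e2 : (δ / n) * n = δ := div_mul_cancel₀ δ hn'.ne'
  nlinarith

/-- [folklore] One smeared interpolation leg: `|Σ_{w∈W} q̇(u;b,b+w)·𝓘(b+w,u′)| ≤ (Σ_w |q̇(u;b,b+w)|)·C_I·e^{2δ}·e^{−(δ∕n)‖b′−b‖∞}` for `u′` seeing `b′`. -/
theorem abs_smearedLeg_le (hδ : 0 < δ) (hn : 1 ≤ n) (hW : ∀ w ∈ W, supNorm w ≤ n)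
    (hI : ∀ c u, |I c u| ≤ C_I * Real.exp (-(δ / n) * (supNorm (c - (n : ℤ) • u) : ℝ))) {b' u' : Pt}
    (hu' : supNorm (b' - (n : ℤ) • u') ≤ n) (u b : Pt) :
    |∑ w ∈ W, qd u b (b + w) * I (b + w) u'|
      ≤ (∑ w ∈ W, |qd u b (b + w)|) * (C_I * Real.exp (2 * δ) * Real.exp (-(δ / n) * (supNorm (b' - b) : ℝ))) := by
  have hC : 0 ≤ C_I := by
    have h := hI b u
    have : 0 < Real.exp (-(δ / n) * (supNorm (b - (n : ℤ) • u) : ℝ)) := Real.exp_pos _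
    nlinarith [abs_nonneg (I b u)]
  rw [Finset.sum_mul]
  refine (Finset.abs_sum_le_sum_abs _ _).trans (Finset.sum_le_sum fun w hw => ?_)
  rw [abs_mul]
  refine mul_le_mul_of_nonneg_left ((hI _ _).trans ?_) (abs_nonneg _)
  rw [mul_assoc]
  exact mul_le_mul_of_nonneg_left (exp_leg_le hδ hn hW hu' hw b) hC

/-- **(MIX-2) POINTWISE SHAPE** (RHOA-DESIGN §2bis «`k ~ (n⁻³)²·e^{−δ|z|∕n}`»): with the letters above,
`|k₂(b,b′)| ≤ (A∕n³)²·(C_I·e^{2δ})²·e^{−(2δ∕n)‖b′−b‖∞}`. [folklore] -/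
theorem abs_mix2_le (hδ : 0 < δ) (hn : 1 ≤ n) (hU : ∀ b, ∀ u ∈ U b, supNorm (b - (n : ℤ) • u) ≤ n)
    (hW : ∀ w ∈ W, supNorm w ≤ n) (hq : ∀ b, ∑ u ∈ U b, ∑ w ∈ W, |qd u b (b + w)| ≤ A / (n : ℝ) ^ 3)
    (hI : ∀ c u, |I c u| ≤ C_I * Real.exp (-(δ / n) * (supNorm (c - (n : ℤ) • u) : ℝ))) (b b' : Pt) :
    |∑ u ∈ U b, ∑ u' ∈ U b', (∑ w ∈ W, qd u b (b + w) * I (b + w) u') * (∑ w' ∈ W, qd u' b' (b' + w') * I (b' + w') u)|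
      ≤ (A / (n : ℝ) ^ 3) ^ 2 * (C_I * Real.exp (2 * δ)) ^ 2 * Real.exp (-(2 * δ / n) * (supNorm (b' - b) : ℝ)) := by
  set E : ℝ := C_I * Real.exp (2 * δ) * Real.exp (-(δ / n) * (supNorm (b' - b) : ℝ)) with hE
  have hC : 0 ≤ C_I := by
    have h := hI b b
    have : 0 < Real.exp (-(δ / n) * (supNorm (b - (n : ℤ) • b) : ℝ)) := Real.exp_pos _
    nlinarith [abs_nonneg (I b b)]
  have hE0 : 0 ≤ E := by positivity
  set m : Pt → Pt → ℝ := fun b u => ∑ w ∈ W, |qd u b (b + w)| with hm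
  have hm0 : ∀ b u, 0 ≤ m b u := fun b u => Finset.sum_nonneg fun w _ => abs_nonneg _
  -- the two smeared legs
  have hX : ∀ u, ∀ u' ∈ U b', |∑ w ∈ W, qd u b (b + w) * I (b + w) u'| ≤ m b u * E :=
    fun u u' hu' => abs_smearedLeg_le hδ hn hW hI (hU b' u' hu') u b
  have hY : ∀ u ∈ U b, ∀ u', |∑ w' ∈ W, qd u' b' (b' + w') * I (b' + w') u| ≤ m b' u' * E := by
    intro u hu u'
    have h := abs_smearedLeg_le (qd := qd) hδ hn hW hI (hU b u hu) u' b'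
    have e : (supNorm (b - b') : ℝ) = supNorm (b' - b) := by rw [← supNorm_neg, neg_sub]
    rwa [e] at h
  calc |∑ u ∈ U b, ∑ u' ∈ U b', (∑ w ∈ W, qd u b (b + w) * I (b + w) u') * (∑ w' ∈ W, qd u' b' (b' + w') * I (b' + w') u)|
      ≤ ∑ u ∈ U b, ∑ u' ∈ U b', (m b u * E) * (m b' u' * E) := by
        refine (Finset.abs_sum_le_sum_abs _ _).trans (Finset.sum_le_sum fun u hu =>
          (Finset.abs_sum_le_sum_abs _ _).trans (Finset.sum_le_sum fun u' hu' => ?_))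
        rw [abs_mul]
        exact mul_le_mul (hX u u' hu') (hY u hu u') (abs_nonneg _) (mul_nonneg (hm0 b u) hE0)
    _ = E ^ 2 * ((∑ u ∈ U b, m b u) * (∑ u' ∈ U b', m b' u')) := by
        rw [Finset.sum_mul_sum]
        rw [Finset.mul_sum]
        refine Finset.sum_congr rfl fun u _ => ?_
        rw [Finset.mul_sum]
        exact Finset.sum_congr rfl fun u' _ => by ring
    _ ≤ E ^ 2 * ((A / (n : ℝ) ^ 3) * (A / (n : ℝ) ^ 3)) := by
        have h1 : ∑ u ∈ U b, m b u ≤ A / (n : ℝ) ^ 3 := hq b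
        have h2 : ∑ u' ∈ U b', m b' u' ≤ A / (n : ℝ) ^ 3 := hq b'
        have hA : 0 ≤ A / (n : ℝ) ^ 3 := (Finset.sum_nonneg fun u _ => hm0 b u).trans h1
        exact mul_le_mul_of_nonneg_left (mul_le_mul h1 h2 (Finset.sum_nonneg fun u _ => hm0 b' u) hA) (sq_nonneg E)
    _ = (A / (n : ℝ) ^ 3) ^ 2 * (C_I * Real.exp (2 * δ)) ^ 2 * Real.exp (-(2 * δ / n) * (supNorm (b' - b) : ℝ)) := by
        have e2 : Real.exp (-(2 * δ / n) * (supNorm (b' - b) : ℝ)) = Real.exp (-(δ / n) * (supNorm (b' - b) : ℝ)) ^ 2 := by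
          rw [sq, ← Real.exp_add]; congr 1; ring
        rw [e2, hE]; ring

/-- **(MIX-2) SECOND MOMENT, n-FREE**: for every finite set `S` of second insertions,
`Σ_{b′∈S} ‖b′−b‖∞²·|k₂(b,b′)| ≤ A²·(C_I·e^{2δ})²·(1 + 9600·e^{δ}·δ⁻⁶)` — the pointwise shape `n⁻⁶e^{−(2δ∕n)|z|}` against the engine's
`Σ |z|²e^{−(2δ∕n)|z|} ≤ (…)·n⁶`: EXACT power `n⁻⁶·n⁶` (RHOA-DESIGN §2bis (MIX-2)). [folklore] -/
theorem mix2_secondMoment_le (hδ : 0 < δ) (hn : 1 ≤ n) (hU : ∀ b, ∀ u ∈ U b, supNorm (b - (n : ℤ) • u) ≤ n)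
    (hW : ∀ w ∈ W, supNorm w ≤ n) (hq : ∀ b, ∑ u ∈ U b, ∑ w ∈ W, |qd u b (b + w)| ≤ A / (n : ℝ) ^ 3)
    (hI : ∀ c u, |I c u| ≤ C_I * Real.exp (-(δ / n) * (supNorm (c - (n : ℤ) • u) : ℝ))) (b : Pt) (S : Finset Pt) :
    ∑ b' ∈ S, (supNorm (b' - b) : ℝ) ^ 2 *
        |∑ u ∈ U b, ∑ u' ∈ U b', (∑ w ∈ W, qd u b (b + w) * I (b + w) u') * (∑ w' ∈ W, qd u' b' (b' + w') * I (b' + w') u)|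
      ≤ A ^ 2 * (C_I * Real.exp (2 * δ)) ^ 2 * (1 + 9600 * Real.exp δ * δ⁻¹ ^ 6) := by
  have hn' : (0 : ℝ) < n := by exact_mod_cast hn
  have h2δ : 0 < 2 * δ := by linarith
  set g : Pt → ℝ := fun z => (supNorm z : ℝ) ^ 2 * Real.exp (-(2 * δ / n) * (supNorm z : ℝ)) with hg
  -- termwise pointwise shape
  have hterm : ∀ b' ∈ S, (supNorm (b' - b) : ℝ) ^ 2 *
      |∑ u ∈ U b, ∑ u' ∈ U b', (∑ w ∈ W, qd u b (b + w) * I (b + w) u') * (∑ w' ∈ W, qd u' b' (b' + w') * I (b' + w') u)|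
        ≤ ((A / (n : ℝ) ^ 3) ^ 2 * (C_I * Real.exp (2 * δ)) ^ 2) * g (b' - b) := by
    intro b' _
    have h := abs_mix2_le hδ hn hU hW hq hI b b'
    have h0 : 0 ≤ (supNorm (b' - b) : ℝ) ^ 2 := by positivity
    calc _ ≤ (supNorm (b' - b) : ℝ) ^ 2 * ((A / (n : ℝ) ^ 3) ^ 2 * (C_I * Real.exp (2 * δ)) ^ 2 *
          Real.exp (-(2 * δ / n) * (supNorm (b' - b) : ℝ))) := mul_le_mul_of_nonneg_left h h0
      _ = _ := by rw [hg]; ring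
  -- reindex by the separation and apply the engine at rate `2δ`
  have hinj : Set.InjOn (fun b' : Pt => b' - b) S := fun x _ y _ h => sub_left_injective h
  have hsum : ∑ b' ∈ S, g (b' - b) = ∑ z ∈ S.image (fun b' => b' - b), g z := (Finset.sum_image hinj).symm
  have heng : ∑ z ∈ S.image (fun b' => b' - b), g z ≤ (1 + 9600 * Real.exp (2 * δ / 2) * (2 / (2 * δ)) ^ 6) * (n : ℝ) ^ 6 :=
    sum_sq_mul_exp_le h2δ hn _
  have e1 : Real.exp (2 * δ / 2) = Real.exp δ := by congr 1; ring
  have e2 : (2 / (2 * δ)) = δ⁻¹ := by field_simp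
  rw [e1, e2] at heng
  have hK : 0 ≤ (A / (n : ℝ) ^ 3) ^ 2 * (C_I * Real.exp (2 * δ)) ^ 2 := by positivity
  calc _ ≤ ∑ b' ∈ S, ((A / (n : ℝ) ^ 3) ^ 2 * (C_I * Real.exp (2 * δ)) ^ 2) * g (b' - b) := Finset.sum_le_sum hterm
    _ = ((A / (n : ℝ) ^ 3) ^ 2 * (C_I * Real.exp (2 * δ)) ^ 2) * ∑ z ∈ S.image (fun b' => b' - b), g z := by
        rw [← Finset.mul_sum, hsum]
    _ ≤ ((A / (n : ℝ) ^ 3) ^ 2 * (C_I * Real.exp (2 * δ)) ^ 2) * ((1 + 9600 * Real.exp δ * δ⁻¹ ^ 6) * (n : ℝ) ^ 6) :=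
        mul_le_mul_of_nonneg_left heng hK
    _ = A ^ 2 * (C_I * Real.exp (2 * δ)) ^ 2 * (1 + 9600 * Real.exp δ * δ⁻¹ ^ 6) := by
        field_simp

end Mix2

end Summit.QuantumFields.BalabanUV.Beta.FP.MixLoopPowerCounting

end
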